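import Mathlib
import Literature.RingTheory.TwoVariableSeries.Basic
import Summits.ResolutionOfSingularities.ResolutionOfSingularities.Theorems.WeightedInvariantLocalWeightedDropMonicDescentShear
import Summits.ResolutionOfSingularities.ResolutionOfSingularities.Theorems.WeightedInvariantLocalWeightedDropMonicDescentInvariantLaws

/-!
# `WeightedInvariant.LocalWeightedDrop`, sub-stub N4″: the scaled Newton set under the `u₂`-shear and under the blow-up of `V(y,u₂)` (tools for T-5′)

Crux item stmt-ResolutionOfSingularities-8899 `LocalWeightedDrop` (route `ResolutionOfSingularities/WeightedInvariant`), door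
`WeightedConstruction` stmt-ResolutionOfSingularities-0571.  [OURS · L1 W4.3, chain w43, lead prover; tools for piece T-5′ (`stub_monicDescentNoChain`)
of `N4PRIME-PLAN.md`.  MODEL: Cossart–Jannsen–Saito LNM 2270 Lemma 13.6 (the change `ũ₂ = u₂ − φu₁` keeps `v = (α, β)` and its initial form)
and Lemma 12.4 (curve blow-up), in label form.]

* `newtonSet_shear_col` — on the columns `P₀ ≤ 2α` the scaled Newton sets of `(A₀, A₁)` and of the sheared label `(shear h A₀, shear h A₁)`
  COINCIDE (from `coeff_shear_pair_of_le`, p486967); hence `alphaL_shear_eq`, `betaL_shear_eq`, and `isOdd_shear_iff_of_col` (oddness of the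
  points on those columns is the same) — CJS 13.6 for labels;
* blow-up of `V(y,u₂)` (`divTwo 2 A₀, divTwo 1 A₁`, all points with `P₁ ≥ 2`): `newtonSet_divTwo` (image under `shiftTwo`), `isOdd_divTwo_iff`,
  `isVertex_of_isVertex_image_shiftTwo`, `wellPrepared_divTwo` (mirror of `…TransportLaws`).
-/

set_option linter.dupNamespace false -- mandated namespace of this single-conjunct summit

noncomputable section

namespace Summit.ResolutionOfSingularities.ResolutionOfSingularities.Theorems

namespace MonicDescent

open MvPowerSeries Literature.RingTheory.TwoVariableSeries

variable {k : Type} [Field k]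

/-! ## The `u₂`-shear keeps the columns `≤ 2α` of the scaled Newton set -/

/-- On the columns `P₀ ≤ 2α(A₀,A₁)`, membership in the scaled Newton set is the same for the label and its `u₂`-shear. -/
theorem newtonSet_shear_col (h A₀ A₁ : MvPowerSeries (Fin 2) k) {P : Fin 2 →₀ ℕ} (hP0 : P 0 ≤ alphaL (newtonSet A₀ A₁)) :
    P ∈ newtonSet (shear h A₀) (shear h A₁) ↔ P ∈ newtonSet A₀ A₁ := by
  obtain ⟨h₀, h₁⟩ := coeff_shear_pair_of_le h A₀ A₁ (alphaL (newtonSet A₀ A₁)) (fun Q hQ => alphaL_le hQ)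
  constructor
  · rintro (hc | ⟨e, rfl, he⟩)
    · change coeff P (shear h A₀) ≠ 0 at hc
      rw [h₀ P hP0] at hc
      exact Or.inl hc
    · refine Or.inr ⟨e, rfl, ?_⟩
      have h2 : 2 * e 0 ≤ alphaL (newtonSet A₀ A₁) := by simpa [Finsupp.smul_apply] using hP0
      rwa [h₁ e h2] at he
  · rintro (hc | ⟨e, rfl, he⟩)
    · change coeff P A₀ ≠ 0 at hc
      rw [← h₀ P hP0] at hc
      exact Or.inl hc
    · refine Or.inr ⟨e, rfl, ?_⟩
      have h2 : 2 * e 0 ≤ alphaL (newtonSet A₀ A₁) := by simpa [Finsupp.smul_apply] using hP0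
      rwa [← h₁ e h2] at he

/-- On the columns `P₀ ≤ 2α`, ODDNESS is the same for the label and its `u₂`-shear. -/
theorem isOdd_shear_iff_of_col (h A₀ A₁ : MvPowerSeries (Fin 2) k) {P : Fin 2 →₀ ℕ} (hP0 : P 0 ≤ alphaL (newtonSet A₀ A₁)) :
    IsOdd (shear h A₀) (shear h A₁) P ↔ IsOdd A₀ A₁ P := by
  obtain ⟨h₀, h₁⟩ := coeff_shear_pair_of_le h A₀ A₁ (alphaL (newtonSet A₀ A₁)) (fun Q hQ => alphaL_le hQ)
  constructor
  · rintro (⟨e, rfl, he⟩ | ⟨hc, hi⟩)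
    · refine Or.inl ⟨e, rfl, ?_⟩
      have h2 : 2 * e 0 ≤ alphaL (newtonSet A₀ A₁) := by simpa [Finsupp.smul_apply] using hP0
      rwa [h₁ e h2] at he
    · exact Or.inr ⟨by rwa [h₀ P hP0] at hc, hi⟩
  · rintro (⟨e, rfl, he⟩ | ⟨hc, hi⟩)
    · refine Or.inl ⟨e, rfl, ?_⟩
      have h2 : 2 * e 0 ≤ alphaL (newtonSet A₀ A₁) := by simpa [Finsupp.smul_apply] using hP0
      rwa [← h₁ e h2] at he
    · exact Or.inr ⟨by rwa [← h₀ P hP0] at hc, hi⟩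

/-- The `u₂`-shear does not change `2α` (CJS Lemma 13.6). -/
theorem alphaL_shear_eq (h A₀ A₁ : MvPowerSeries (Fin 2) k) (hN : (newtonSet A₀ A₁).Nonempty) :
    alphaL (newtonSet (shear h A₀) (shear h A₁)) = alphaL (newtonSet A₀ A₁) := by
  obtain ⟨P, hP, hP0⟩ := exists_eq_alphaL hN
  apply le_antisymm
  · rw [← hP0]
    exact alphaL_le ((newtonSet_shear_col h A₀ A₁ hP0.le).mpr hP)
  · by_contra hlt
    push Not at hlt
    obtain ⟨Q, hQ, hQ0⟩ := exists_eq_alphaL (N := newtonSet (shear h A₀) (shear h A₁))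
      ⟨P, (newtonSet_shear_col h A₀ A₁ hP0.le).mpr hP⟩
    have hQold : Q ∈ newtonSet A₀ A₁ := (newtonSet_shear_col h A₀ A₁ (by rw [hQ0]; exact hlt.le)).mp hQ
    have := alphaL_le hQold
    omega

/-- The `u₂`-shear does not change `2β` (CJS Lemma 13.6). -/
theorem betaL_shear_eq (h A₀ A₁ : MvPowerSeries (Fin 2) k) (hN : (newtonSet A₀ A₁).Nonempty) :
    betaL (newtonSet (shear h A₀) (shear h A₁)) = betaL (newtonSet A₀ A₁) := by
  have hα := alphaL_shear_eq h A₀ A₁ hN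
  unfold betaL
  rw [hα]
  congr 1
  ext n
  constructor
  · rintro ⟨Q, ⟨hQ, hQ0⟩, rfl⟩
    exact ⟨Q, ⟨(newtonSet_shear_col h A₀ A₁ hQ0.le).mp hQ, hQ0⟩, rfl⟩
  · rintro ⟨Q, ⟨hQ, hQ0⟩, rfl⟩
    exact ⟨Q, ⟨(newtonSet_shear_col h A₀ A₁ hQ0.le).mpr hQ, hQ0⟩, rfl⟩

/-! ## The blow-up of `V(y,u₂)`: image under `shiftTwo` -/

/-- Exact transport under `divTwo`: the coefficient at `e − (0,c)`. -/
theorem coeff_divTwo_shift (c : ℕ) (A : MvPowerSeries (Fin 2) k) (e : Fin 2 →₀ ℕ) (he : c ≤ e 1) :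
    coeff (Finsupp.single 0 (e 0) + Finsupp.single 1 (e 1 - c)) (divTwo c A) = coeff e A := by
  rw [coeff_divTwo]
  have hidx : Finsupp.single 0 (e 0) + Finsupp.single 1 (e 1 - c) + Finsupp.single 1 c = e := by
    refine finsupp_fin2_ext ?_ ?_
    · simp only [Finsupp.add_apply, Finsupp.single_apply]
      simp
    · simp only [Finsupp.add_apply, Finsupp.single_apply]
      simp
      omega
  rw [hidx]

/-- THE SCALED NEWTON SET UNDER THE BLOW-UP OF `V(y,u₂)` is the image under `shiftTwo` (all points with `P₁ ≥ 2`; CJS Lemma 12.4). -/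
theorem newtonSet_divTwo (A₀ A₁ : MvPowerSeries (Fin 2) k) (hN : ∀ P ∈ newtonSet A₀ A₁, 2 ≤ P 1) :
    newtonSet (divTwo 2 A₀) (divTwo 1 A₁) = shiftTwo '' newtonSet A₀ A₁ := by
  ext d
  constructor
  · rintro (hd | ⟨e', rfl, he'⟩)
    · change coeff d (divTwo 2 A₀) ≠ 0 at hd
      rw [coeff_divTwo] at hd
      refine ⟨d + Finsupp.single 1 2, Or.inl hd, finsupp_fin2_ext ?_ ?_⟩
      · simp only [shiftTwo_apply_zero, Finsupp.add_apply, Finsupp.single_apply]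
        simp
      · simp only [shiftTwo_apply_one, Finsupp.add_apply, Finsupp.single_apply]
        simp
    · rw [coeff_divTwo] at he'
      refine ⟨2 • (e' + Finsupp.single 1 1), Or.inr ⟨_, rfl, he'⟩, finsupp_fin2_ext ?_ ?_⟩
      · simp only [shiftTwo_apply_zero, Finsupp.smul_apply, Finsupp.add_apply, Finsupp.single_apply, smul_eq_mul]
        simp
      · simp only [shiftTwo_apply_one, Finsupp.smul_apply, Finsupp.add_apply, Finsupp.single_apply, smul_eq_mul]
        simp
        omega
  · rintro ⟨P, hP, rfl⟩
    have h2 := hN P hP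
    rcases hP with hP | ⟨e, rfl, he⟩
    · left
      change coeff (shiftTwo P) (divTwo 2 A₀) ≠ 0
      rw [shiftTwo]
      rwa [coeff_divTwo_shift 2 A₀ P h2]
    · right
      have h1 : 1 ≤ e 1 := by
        simp only [Finsupp.smul_apply, smul_eq_mul] at h2
        omega
      refine ⟨Finsupp.single 0 (e 0) + Finsupp.single 1 (e 1 - 1), finsupp_fin2_ext ?_ ?_, ?_⟩
      · simp only [shiftTwo_apply_zero, Finsupp.smul_apply, Finsupp.add_apply, Finsupp.single_apply, smul_eq_mul]
        simp
      · simp only [shiftTwo_apply_one, Finsupp.smul_apply, Finsupp.add_apply, Finsupp.single_apply, smul_eq_mul]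
        simp
        omega
      · rwa [coeff_divTwo_shift 1 A₁ e h1]

/-- Oddness is transported under the blow-up of `V(y,u₂)`. -/
theorem isOdd_divTwo_iff (A₀ A₁ : MvPowerSeries (Fin 2) k) (hN : ∀ P ∈ newtonSet A₀ A₁, 2 ≤ P 1)
    {P : Fin 2 →₀ ℕ} (hP : P ∈ newtonSet A₀ A₁) :
    IsOdd (divTwo 2 A₀) (divTwo 1 A₁) (shiftTwo P) ↔ IsOdd A₀ A₁ P := by
  have h2 := hN P hP
  have hshift : shiftTwo P = Finsupp.single 0 (P 0) + Finsupp.single 1 (P 1 - 2) := rfl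
  constructor
  · rintro (⟨e', he'eq, he'⟩ | ⟨hc, i, hi⟩)
    · left
      rw [coeff_divTwo] at he'
      refine ⟨e' + Finsupp.single 1 1, finsupp_fin2_ext ?_ ?_, he'⟩
      · have := congrArg (fun Q => Q 0) he'eq
        simp only [shiftTwo_apply_zero, Finsupp.smul_apply, smul_eq_mul] at this
        simp only [Finsupp.smul_apply, Finsupp.add_apply, Finsupp.single_apply, smul_eq_mul]
        simp
        omega
      · have := congrArg (fun Q => Q 1) he'eq
        simp only [shiftTwo_apply_one, Finsupp.smul_apply, smul_eq_mul] at this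
        simp only [Finsupp.smul_apply, Finsupp.add_apply, Finsupp.single_apply, smul_eq_mul]
        simp
        omega
    · right
      rw [hshift, coeff_divTwo_shift 2 A₀ P h2] at hc
      refine ⟨hc, ?_⟩
      have hi2 : i = 0 ∨ i = 1 := by fin_cases i <;> simp
      rcases hi2 with rfl | rfl
      · simp only [shiftTwo_apply_zero] at hi
        exact ⟨0, hi⟩
      · simp only [shiftTwo_apply_one] at hi
        refine ⟨1, fun h1 => hi ?_⟩
        obtain ⟨a, ha⟩ := h1
        exact ⟨a - 1, by omega⟩
  · rintro (⟨e, rfl, he⟩ | ⟨hc, i, hi⟩)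
    · left
      have h1 : 1 ≤ e 1 := by
        simp only [Finsupp.smul_apply, smul_eq_mul] at h2
        omega
      refine ⟨Finsupp.single 0 (e 0) + Finsupp.single 1 (e 1 - 1), finsupp_fin2_ext ?_ ?_, ?_⟩
      · simp only [shiftTwo_apply_zero, Finsupp.smul_apply, Finsupp.add_apply, Finsupp.single_apply, smul_eq_mul]
        simp
      · simp only [shiftTwo_apply_one, Finsupp.smul_apply, Finsupp.add_apply, Finsupp.single_apply, smul_eq_mul]
        simp
        omega
      · rwa [coeff_divTwo_shift 1 A₁ e h1]
    · right
      refine ⟨by rw [hshift, coeff_divTwo_shift 2 A₀ P h2]; exact hc, ?_⟩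
      have hi2 : i = 0 ∨ i = 1 := by fin_cases i <;> simp
      rcases hi2 with rfl | rfl
      · exact ⟨0, by simpa using hi⟩
      · refine ⟨1, fun h1 => hi ?_⟩
        simp only [shiftTwo_apply_one] at h1
        obtain ⟨a, ha⟩ := h1
        exact ⟨a + 1, by omega⟩

/-- A vertex of `shiftTwo '' N` comes from a vertex of `N` (same weight; all points with `P₁ ≥ 2`). -/
theorem isVertex_of_isVertex_image_shiftTwo {N : Set (Fin 2 →₀ ℕ)} (hN : ∀ P ∈ N, 2 ≤ P 1) {P : Fin 2 →₀ ℕ} (hP : P ∈ N)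
    (hv : IsVertex (shiftTwo '' N) (shiftTwo P)) : IsVertex N P := by
  obtain ⟨-, w, hw, hmin⟩ := hv
  refine ⟨hP, w, hw, fun Q hQ hne => ?_⟩
  have hPs := hN P hP
  have hQs := hN Q hQ
  have hneq : shiftTwo Q ≠ shiftTwo P := by
    intro hh
    apply hne
    have h0 := congrArg (fun R => R 0) hh
    have h1 := congrArg (fun R => R 1) hh
    simp only [shiftTwo_apply_zero, shiftTwo_apply_one] at h0 h1
    exact finsupp_fin2_ext h0 (by omega)
  have hlt := hmin (shiftTwo Q) ⟨Q, hQ, rfl⟩ hneq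
  have hwt : ∀ R : Fin 2 →₀ ℕ, 2 ≤ R 1 → Finsupp.weight w (shiftTwo R) + 2 * w 1 = Finsupp.weight w R := by
    intro R hR
    rw [Finsupp.weight_apply, Finsupp.weight_apply, Finsupp.sum_fintype _ _ (by simp), Finsupp.sum_fintype _ _ (by simp)]
    simp only [Fin.sum_univ_two, smul_eq_mul, shiftTwo_apply_zero, shiftTwo_apply_one]
    have : (R 1 - 2) * w 1 + 2 * w 1 = R 1 * w 1 := by
      rw [← Nat.add_mul]; congr 1; omega
    nlinarith [this]
  have := hwt P hPs
  have := hwt Q hQs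
  omega

/-- WELL-PREPAREDNESS PERSISTS under the blow-up of `V(y,u₂)`. -/
theorem wellPrepared_divTwo (A₀ A₁ : MvPowerSeries (Fin 2) k) (hN : ∀ P ∈ newtonSet A₀ A₁, 2 ≤ P 1)
    (hWP : WellPrepared A₀ A₁) : WellPrepared (divTwo 2 A₀) (divTwo 1 A₁) := by
  intro Q hQ
  have hQmem : Q ∈ newtonSet (divTwo 2 A₀) (divTwo 1 A₁) := hQ.1
  rw [newtonSet_divTwo A₀ A₁ hN] at hQmem
  obtain ⟨P, hP, rfl⟩ := hQmem
  rw [isOdd_divTwo_iff A₀ A₁ hN hP]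
  refine hWP P (isVertex_of_isVertex_image_shiftTwo hN hP ?_)
  rwa [← newtonSet_divTwo A₀ A₁ hN]

end MonicDescent

end Summit.ResolutionOfSingularities.ResolutionOfSingularities.Theorems

end
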